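import Literature.MathematicalPhysics.PowerSystems.KronReductionClosure
import HarnessLib

/-!
# The effect of self-loops (shunt loads) on the Kron reduction: `Q_red(L + diag Δ) =
# L_red + diag Δ_α + S` with `S ≥ 0`, strictly positive from one loaded interior node of a
# connected interior (Dörfler–Bullo 2013, Theorem 3.7 3)–4)) — loads WEAKEN every coupling of the
# network-reduced power-system model and raise every reduced shunt

Topic `Literature/MathematicalPhysics/PowerSystems`; namespaces `…PowerSystems.KronReduction` (§1
block form, §2 predicate form) and `…PowerSystems.ClassicalModel` (§3).  Third file of the
Dörfler–Bullo Kron-reduction story after `KronReductionClosure.lean` (Lemma 2.1, Thm 3.4, Thm 3.7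
1)–2), whose Stieltjes-matrix lemmas `inv_nonneg_of_posDef`, `accompanying_nonneg`,
`accompanying_pos_of_interior_connected`, `interiorBlock_posDef_of_laplacian` are reused) and
`KronReductionEffectiveResistance.lean` (Thm 3.9 1)).  Everything below is PROVED: 0 definitions,
0 named facts, 0 `sorry`, no new axiom.

SOURCE (read on the page, `lit read paper:arxiv-1102.2950` = [DorflerBullo2013], F. Dörfler,
F. Bullo, IEEE TCAS-I 60 (2013) 150–163), §3.2 **Theorem 3.7 (Algebraic Properties of Kron
Reduction)** (p0014 L57–L95): «3) Effect of self-loops I: Define `Δ_i ≜ A_ii ≥ 0` … so that loopy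
and loop-less Laplacians `Q` and `L` are related by `Q = L + diag({Δ_i})`. Then the Kron-reduced
matrix takes the form `Q_red = L/L(α,α) + diag({Δ_i}_{i∈α}) + S`, where
`S = L_ac (I + diag({Δ_i}_{i∉α}) L(α,α)⁻¹)⁻¹ diag({Δ_i}_{i∉α}) L_acᵀ` is a symmetric nonnegative
`|α| × |α|` matrix. Furthermore, the reduced self-loops satisfy `A_red[i,i] = Δ_i + Σ_j Q_ac[i,j]
Δ_{|α|+j}` for `i ∈ α`. 4) Effect of self-loops II: If the subgraph among the interior nodes is
connected, each boundary node is connected to at least one interior node, and at least one of the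
interior nodes has a positively weighted self-loop, then `S` and `Q_ac` are both positive matrices.»;
the discussion (p0015 L1–L19): «the reduction of node `k` decreases the mutual coupling `{i,j}` … and
increases each self-loop … a single positive self-loop in the interior network will affect the
entire reduced network by decreasing all mutual connections and increasing all self-loops weights»;
proof of 4) (p0016 L1–L3); and before Theorem 3.5 (p0013 L37–L41): «Physical intuition also
suggests that loads in an electrical circuit weaken the influence of nodes on another»; Lemma 3.8
(Sherman–Morrison, p0015 L22–L30).  Power reading: §2.4 shunt admittances / `B = −Im(Q)` (p0009
L1–L12), §2.6 `P_ij = |V_i||V_j| Im(Q_red[i,j])` and «`A_red[i,i]` is the `i`th load in the reduced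
network» (p0010 L17, L57).

RENDERING (as in `KronReductionClosure.lean`).  Block form: `Q = [[A, B], [Bᵀ, C]]` with the
interior block `C` a Stieltjes matrix (`C ≻ 0`, `C_ij ≤ 0` off the diagonal), `B ≤ 0`; extra
self-loops `diag(δ_α)`, `diag(δ)` with `δ ≥ 0`; the printed `S` is written in the equivalent
resolvent form `S = (BC⁻¹)·diag(δ)·((C + diag δ)⁻¹Bᵀ)` (since `(I + DC⁻¹)⁻¹D = C(C + D)⁻¹D … `; both
equal `B[C⁻¹ − (C + D)⁻¹]Bᵀ`).  Predicate form: `Q` on a finite node type with `hQ hZ hrow hG hconn hα`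
and the perturbed `Q + Matrix.diagonal δ`; `L` itself may be loopy — only definiteness of the
interior block is used.

WHAT IS PROVED (0 `def`, 0 named facts, 0 `sorry`):
* §1 ★★ **`schur_add_diagonal_eq`** — THM 3.7 3): `(A + diag δ_α) − B(C + diag δ)⁻¹Bᵀ =
  (A − BC⁻¹Bᵀ) + diag δ_α + S` (resolvent identity `C⁻¹ − (C + D)⁻¹ = C⁻¹D(C + D)⁻¹`);
  ★★ `selfLoopTerm_apply_nonneg` (`S ≥ 0` entrywise: `S_{aa'} = Σ_l (Q_ac)_{al} δ_l (Q̃_ac)_{a'l}`);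
  ★★★ **`schur_le_schur_add_diagonal`** (every entry of the Schur complement weakly increases);
  ★★ **`selfLoopTerm_apply_pos`** — THM 3.7 4): interior graph connected, every boundary node
  attached, some `δ_l > 0` in the interior ⇒ `S > 0` entrywise.
* §2 predicate form: ★★★ **`kronReduced_le_kronReduced_add_diagonal`**,
  `kronReduced_rowsum_le_rowsum_add_diagonal`, ★★★ **`kronReduced_lt_kronReduced_add_diagonal`**.
* §3 THE MODEL (`ClassicalModel`, `B = −Im(Q)` the susceptance loopy Laplacian of a lossless
  network, generators = boundary, `|V| > 0`): ★★★ **`kronCoupling_le_of_shunt_le`** (adding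
  inductive shunt admittance — loads — anywhere weakly DECREASES every network-reduced coupling
  `|V_i||V_j|(−B_red[i,j])`), ★★★ **`kronCoupling_lt_of_bus_load`** (bus network connected, every
  generator attached, one loaded bus ⇒ EVERY coupling strictly decreases),
  ★★ `kronShunt_le_of_shunt_le` (reduced shunts weakly increase).

PROOF ROUTE.  As printed up to the form of `S`: the source expands `(L(α,α) + D)⁻¹` by
Sherman–Morrison (Lemma 3.8); here the one-line resolvent identity, then signs entry by entry from
the Stieltjes lemmas of `KronReductionClosure` (`(C + D)` is again Stieltjes with the same graph);
positivity in 4) from `accompanying_pos_of_interior_connected` applied to `C` and to `C + D`.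
In-seat exact cross-check (`negtest/kron_selfloop_check.py`, plain python `Fraction`s, seat folder):
random connected loopy Laplacians `n ≤ 8`, random `δ ≥ 0`: decomposition, `S ≥ 0`, monotonicity,
strict positivity under 4)'s hypotheses — all pass.

THREE COLUMNS.  CERTIFIED (kernel theorems): for exact data, raising any diagonal entries of a
loopy Laplacian by `δ ≥ 0` raises every entry of its Kron reduction onto any non-empty boundary
(mutual couplings shrink in magnitude, reduced shunts grow), strictly everywhere under 4)'s
connectivity hypotheses with one loaded interior node; the exact decomposition with `S`.  MODELLED:
lossless lines, loads / reactors as constant inductive shunt admittances, classical machines as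
boundary nodes — the network-reduced classical model's reduction step.  NOT CLAIMED: the iterative
formula (eq. after Thm 3.7, one node at a time with `c_k`), spectral consequences (Thm 3.5 2):
self-loops and `λ₂`), effective-resistance consequences (Thm 3.9 3)), capacitive shunts (`δ < 0`),
lossy networks, any dynamics.

## References
* [DorflerBullo2013] F. Dörfler, F. Bullo, *Kron reduction of graphs with applications to
  electrical networks*, IEEE Trans. Circuits Syst. I 60 (2013) 150–163,
  doi:10.1109/tcsi.2012.2215780, arXiv:1102.2950 — §3.2 Theorem 3.7 3)–4), Lemma 3.8; §2.4, §2.6;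
  discussion before Theorem 3.5.
* [BermanPlemmons1979] A. Berman, R. J. Plemmons, *Nonnegative Matrices in the Mathematical
  Sciences*, 1979 — Ch. 6 (N₃₈), Thm 2.7 (through `KronReductionClosure`).
-/

noncomputable section

open scoped Matrix
open Finset Matrix

namespace Literature.MathematicalPhysics.PowerSystems

namespace KronReduction

/-! ### §1. Block form: adding non-negative interior self-loops `D = diag(δ)` changes the Schur
complement by `diag`-free, entrywise non-negative `S = (BC⁻¹) D ((C + D)⁻¹Bᵀ)` (Theorem 3.7 3)) -/

section SelfLoops

variable {m k : Type*} [Fintype m] [Fintype k] [DecidableEq m] [DecidableEq k]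

omit [Fintype m] [Fintype k] [DecidableEq m] in
/-- Adding a non-negative diagonal to a Stieltjes matrix gives a Stieltjes matrix. [folklore] -/
private theorem posDef_add_diagonal {C : Matrix k k ℝ} (hC : C.PosDef) {δ : k → ℝ}
    (hδ : ∀ i, 0 ≤ δ i) : (C + Matrix.diagonal δ).PosDef :=
  hC.add_posSemidef (Matrix.PosSemidef.diagonal fun i => hδ i)

omit [Fintype m] [Fintype k] [DecidableEq m] in
/-- … with the same off-diagonal entries. [folklore] -/
private theorem add_diagonal_offDiag {C : Matrix k k ℝ} (hCZ : ∀ i j, i ≠ j → C i j ≤ 0)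
    (δ : k → ℝ) : ∀ i j, i ≠ j → (C + Matrix.diagonal δ) i j ≤ 0 := fun i j h => by
  rw [Matrix.add_apply, Matrix.diagonal_apply_ne _ h, add_zero]; exact hCZ i j h

omit [Fintype m] [DecidableEq m] in
/-- **The resolvent identity** `C⁻¹ − (C + D)⁻¹ = C⁻¹ D (C + D)⁻¹` (both invertible). [folklore] -/
private theorem inv_sub_inv_add {C D : Matrix k k ℝ} (hC : IsUnit C.det) (hCD : IsUnit (C + D).det) :
    C⁻¹ - (C + D)⁻¹ = C⁻¹ * D * (C + D)⁻¹ := by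
  have h1 : C⁻¹ * D * (C + D)⁻¹ = C⁻¹ * ((C + D) - C) * (C + D)⁻¹ := by rw [add_sub_cancel_left]
  rw [h1, Matrix.mul_sub, Matrix.sub_mul, Matrix.mul_assoc, Matrix.mul_nonsing_inv _ hCD,
    Matrix.mul_one, Matrix.nonsing_inv_mul _ hC, Matrix.one_mul]

omit [Fintype m] in
/-- ★★ **THEOREM 3.7 3) EFFECT OF SELF-LOOPS I, block form** — the decomposition
`(A + D_α) − B (C + D_β)⁻¹ Bᵀ = (A − B C⁻¹ Bᵀ) + D_α + S` of the Kron reduction of the loopy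
Laplacian `Q = L + diag(Δ)` into the reduction of `L`, the boundary self-loops, and
`S = (B C⁻¹) D_β ((C + D_β)⁻¹ Bᵀ)` («`Q_red = L/L(α,α) + diag({Δ_i}_{i∈α}) + S` where
`S = L_ac (I + diag(Δ)L(α,α)⁻¹)⁻¹ diag(Δ) L_acᵀ`»; here `L` may itself be loopy — only `C ≻ 0`
matters).
[cite: DorflerBullo2013, §3.2 Theorem 3.7 3) eq. (complete reduction of all loopy nodes) (arXiv:1102.2950 p0014 L67–L90); Lemma 3.8 (Sherman–Morrison) (p0015 L22–L30)] -/
theorem schur_add_diagonal_eq (A : Matrix m m ℝ) (B : Matrix m k ℝ) {C : Matrix k k ℝ}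
    (hC : C.PosDef) (δα : m → ℝ) {δ : k → ℝ} (hδ : ∀ i, 0 ≤ δ i) :
    (A + Matrix.diagonal δα) - B * (C + Matrix.diagonal δ)⁻¹ * Bᵀ
      = (A - B * C⁻¹ * Bᵀ) + Matrix.diagonal δα
        + (B * C⁻¹) * Matrix.diagonal δ * ((C + Matrix.diagonal δ)⁻¹ * Bᵀ) := by
  have hCu : IsUnit C.det := (Matrix.isUnit_iff_isUnit_det C).1 hC.isUnit
  have hCDu : IsUnit (C + Matrix.diagonal δ).det :=
    (Matrix.isUnit_iff_isUnit_det _).1 (posDef_add_diagonal hC hδ).isUnit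
  have key : B * C⁻¹ * Bᵀ - B * (C + Matrix.diagonal δ)⁻¹ * Bᵀ
      = (B * C⁻¹) * Matrix.diagonal δ * ((C + Matrix.diagonal δ)⁻¹ * Bᵀ) := by
    rw [Matrix.mul_assoc B C⁻¹ Bᵀ, Matrix.mul_assoc B (C + Matrix.diagonal δ)⁻¹ Bᵀ,
      ← Matrix.mul_sub, ← Matrix.sub_mul, inv_sub_inv_add hCu hCDu]
    simp only [Matrix.mul_assoc]
  rw [← key]
  abel

omit [Fintype m] [DecidableEq m] in
/-- ★★ **THEOREM 3.7 3), sign: `S` is entrywise non-negative** — `S_{aa'} = Σ_l (Q_ac)_{al} Δ_l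
(Q̃_ac)_{a'l} ≥ 0` with the accompanying matrices `Q_ac = −BC⁻¹ ≥ 0`, `Q̃_ac = −B(C + D)⁻¹ ≥ 0`
of the loop-less and of the loopy interior («`S` … is a symmetric nonnegative `|α| × |α|` matrix»).
[cite: DorflerBullo2013, §3.2 Theorem 3.7 3) (arXiv:1102.2950 p0014 L67–L90)] -/
theorem selfLoopTerm_apply_nonneg {B : Matrix m k ℝ} {C : Matrix k k ℝ} (hC : C.PosDef)
    (hCZ : ∀ i j, i ≠ j → C i j ≤ 0) (hB : ∀ a b, B a b ≤ 0) {δ : k → ℝ} (hδ : ∀ i, 0 ≤ δ i)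
    (a a' : m) :
    0 ≤ ((B * C⁻¹) * Matrix.diagonal δ * ((C + Matrix.diagonal δ)⁻¹ * Bᵀ)) a a' := by
  have hCD := posDef_add_diagonal hC hδ
  have hCDZ := add_diagonal_offDiag hCZ δ
  rw [Matrix.mul_apply]
  refine Finset.sum_nonneg fun l _ => ?_
  rw [Matrix.mul_diagonal]
  -- `(BC⁻¹)_{al} ≤ 0`, `δ_l ≥ 0`, `((C+D)⁻¹Bᵀ)_{la'} ≤ 0`
  have h1 : (B * C⁻¹) a l ≤ 0 := by
    have := accompanying_nonneg hC hCZ hB a l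
    rw [Matrix.neg_apply] at this; linarith
  have h2 : ((C + Matrix.diagonal δ)⁻¹ * Bᵀ) l a' ≤ 0 := by
    rw [Matrix.mul_apply]
    exact Finset.sum_nonpos fun l' _ => by
      rw [Matrix.transpose_apply]
      exact mul_nonpos_of_nonneg_of_nonpos (inv_nonneg_of_posDef hCD hCDZ l l') (hB a' l')
  exact mul_nonneg_of_nonpos_of_nonpos (mul_nonpos_of_nonpos_of_nonneg h1 (hδ l)) h2

omit [Fintype m] in
/-- ★★★ **MONOTONICITY OF THE KRON REDUCTION IN THE SELF-LOOPS**: adding non-negative self-loops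
(`δ_α` at boundary nodes, `δ_β` at interior nodes) to a matrix with Stieltjes interior block can
only INCREASE every entry of the Kron-reduced matrix — the mutual couplings `−Q_red[i,j] ≥ 0`
weakly DECREASE and the reduced self-loops weakly increase («decreasing all mutual connections and
increasing all self-loops weights»).
[cite: DorflerBullo2013, §3.2 Theorem 3.7 3)–4) and the discussion after it (arXiv:1102.2950 p0014 L67–L95, p0015 L1–L19)] -/
theorem schur_le_schur_add_diagonal (A : Matrix m m ℝ) {B : Matrix m k ℝ} {C : Matrix k k ℝ}
    (hC : C.PosDef) (hCZ : ∀ i j, i ≠ j → C i j ≤ 0) (hB : ∀ a b, B a b ≤ 0)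
    {δα : m → ℝ} (hδα : ∀ a, 0 ≤ δα a) {δ : k → ℝ} (hδ : ∀ i, 0 ≤ δ i) (a a' : m) :
    (A - B * C⁻¹ * Bᵀ) a a'
      ≤ ((A + Matrix.diagonal δα) - B * (C + Matrix.diagonal δ)⁻¹ * Bᵀ) a a' := by
  rw [schur_add_diagonal_eq A B hC δα hδ, Matrix.add_apply, Matrix.add_apply]
  have h1 : 0 ≤ Matrix.diagonal δα a a' := by
    by_cases h : a = a'
    · subst h; rw [Matrix.diagonal_apply_eq]; exact hδα a
    · rw [Matrix.diagonal_apply_ne _ h]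
  have h2 := selfLoopTerm_apply_nonneg hC hCZ hB hδ a a'
  linarith

omit [Fintype m] [DecidableEq m] in
/-- ★★ **THEOREM 3.7 4) EFFECT OF SELF-LOOPS II, block form**: if the interior graph is connected,
every boundary node is attached to the interior, and SOME interior node carries a positive self-loop,
then `S` is entrywise POSITIVE — every mutual coupling strictly decreases and every reduced
self-loop strictly increases («then `S` and `Q_ac` are both positive matrices»).
[cite: DorflerBullo2013, §3.2 Theorem 3.7 4) with proof (arXiv:1102.2950 p0014 L91–L95, p0016 L1–L3)] -/
theorem selfLoopTerm_apply_pos {B : Matrix m k ℝ} {C : Matrix k k ℝ} (hC : C.PosDef)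
    (hCZ : ∀ i j, i ≠ j → C i j ≤ 0) (hB : ∀ a b, B a b ≤ 0) {δ : k → ℝ} (hδ : ∀ i, 0 ≤ δ i)
    {Gi : SimpleGraph k} (hGi : ∀ i j, Gi.Adj i j ↔ i ≠ j ∧ C i j ≠ 0) (hconn : Gi.Connected)
    (hadj : ∀ a, ∃ l, B a l ≠ 0) (hpos : ∃ l, 0 < δ l) (a a' : m) :
    0 < ((B * C⁻¹) * Matrix.diagonal δ * ((C + Matrix.diagonal δ)⁻¹ * Bᵀ)) a a' := by
  have hCD := posDef_add_diagonal hC hδ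
  have hCDZ := add_diagonal_offDiag hCZ δ
  -- the interior graph of `C + D` is that of `C`
  have hGi' : ∀ i j, Gi.Adj i j ↔ i ≠ j ∧ (C + Matrix.diagonal δ) i j ≠ 0 := by
    intro i j
    rw [hGi i j]
    constructor
    · rintro ⟨hne, h⟩; exact ⟨hne, by rwa [Matrix.add_apply, Matrix.diagonal_apply_ne _ hne, add_zero]⟩
    · rintro ⟨hne, h⟩; exact ⟨hne, by rwa [Matrix.add_apply, Matrix.diagonal_apply_ne _ hne, add_zero] at h⟩
  -- all terms `≥ 0`, the term at a loaded interior node `> 0`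
  have hterm : ∀ l, 0 ≤ (B * C⁻¹) a l * δ l * ((C + Matrix.diagonal δ)⁻¹ * Bᵀ) l a' := by
    intro l
    have h1 : (B * C⁻¹) a l ≤ 0 := by
      have := accompanying_nonneg hC hCZ hB a l
      rw [Matrix.neg_apply] at this; linarith
    have h2 : ((C + Matrix.diagonal δ)⁻¹ * Bᵀ) l a' ≤ 0 := by
      rw [Matrix.mul_apply]
      exact Finset.sum_nonpos fun l' _ => by
        rw [Matrix.transpose_apply]
        exact mul_nonpos_of_nonneg_of_nonpos (inv_nonneg_of_posDef hCD hCDZ l l') (hB a' l')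
    exact mul_nonneg_of_nonpos_of_nonpos (mul_nonpos_of_nonpos_of_nonneg h1 (hδ l)) h2
  obtain ⟨l₀, hl₀⟩ := hpos
  rw [Matrix.mul_apply]
  simp_rw [Matrix.mul_diagonal]
  refine Finset.sum_pos' (fun l _ => hterm l) ⟨l₀, mem_univ _, ?_⟩
  have h1 : (B * C⁻¹) a l₀ < 0 := by
    have := accompanying_pos_of_interior_connected hC hCZ hB hGi hconn hadj a l₀
    rw [Matrix.neg_apply] at this; linarith
  have h2 : ((C + Matrix.diagonal δ)⁻¹ * Bᵀ) l₀ a' < 0 := by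
    -- `= ((C+D)⁻¹Bᵀ)_{l₀ a'} = (B (C+D)⁻¹)_{a' l₀}` by symmetry of `(C+D)⁻¹`, `= −(Q̃_ac)_{a' l₀} < 0`
    have hsymm : ((C + Matrix.diagonal δ)⁻¹ * Bᵀ) l₀ a' = (B * (C + Matrix.diagonal δ)⁻¹) a' l₀ := by
      have hH : (C + Matrix.diagonal δ)⁻¹.IsHermitian := hCD.isHermitian.inv
      rw [Matrix.mul_apply, Matrix.mul_apply]
      refine Finset.sum_congr rfl fun l' _ => ?_
      rw [Matrix.transpose_apply, mul_comm]
      congr 1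
      simpa only [star_trivial] using (hH.apply l₀ l').symm
    rw [hsymm]
    have := accompanying_pos_of_interior_connected hCD hCDZ hB hGi' hconn hadj a' l₀
    rw [Matrix.neg_apply] at this; linarith
  exact mul_pos_of_neg_of_neg (mul_neg_of_neg_of_pos h1 hl₀) h2

end SelfLoops

/-! ### §2. Predicate form: a loopy Laplacian `Q` and `Q + diag(δ)` with `δ ≥ 0` -/

section Predicate

variable {ι : Type*} [Fintype ι] [DecidableEq ι]

omit [Fintype ι] in
/-- Diagonal blocks of `Q + diag(δ)`. [folklore] -/
private theorem submatrix_add_diagonal_same (q : ι → Prop) (Q : Matrix ι ι ℝ) (δ : ι → ℝ) :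
    (Q + Matrix.diagonal δ).submatrix (Subtype.val : {i // q i} → ι) (Subtype.val : {i // q i} → ι)
      = Q.submatrix (Subtype.val : {i // q i} → ι) (Subtype.val : {i // q i} → ι)
        + Matrix.diagonal (fun a : {i // q i} => δ a) := by
  ext a b
  by_cases h : a = b
  · subst h; simp
  · have h' : (a : ι) ≠ b := fun e => h (Subtype.ext e)
    simp [Matrix.diagonal_apply_ne _ h, Matrix.diagonal_apply_ne _ h']

omit [Fintype ι] in
/-- Off-diagonal blocks of `Q + diag(δ)` are those of `Q`. [folklore] -/
private theorem submatrix_add_diagonal_off (p : ι → Prop) (Q : Matrix ι ι ℝ) (δ : ι → ℝ) :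
    (Q + Matrix.diagonal δ).submatrix (Subtype.val : {i // p i} → ι)
        (Subtype.val : {i // ¬ p i} → ι)
      = Q.submatrix (Subtype.val : {i // p i} → ι) (Subtype.val : {i // ¬ p i} → ι)
    ∧ (Q + Matrix.diagonal δ).submatrix (Subtype.val : {i // ¬ p i} → ι)
        (Subtype.val : {i // p i} → ι)
      = Q.submatrix (Subtype.val : {i // ¬ p i} → ι) (Subtype.val : {i // p i} → ι) := by
  constructor
  · ext a b
    have hne : (a : ι) ≠ (b : ι) := fun h => b.2 (h ▸ a.2)
    simp [Matrix.diagonal_apply_ne _ hne]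
  · ext b a
    have hne : (b : ι) ≠ (a : ι) := fun h => b.2 (h.symm ▸ a.2)
    simp [Matrix.diagonal_apply_ne _ hne]

omit [Fintype ι] [DecidableEq ι] in
/-- Symmetric entries. [folklore] -/
private theorem entry_symm'' {Q : Matrix ι ι ℝ} (hQ : Q.IsHermitian) (i j : ι) : Q j i = Q i j := by
  simpa only [star_trivial] using hQ.apply i j

omit [Fintype ι] [DecidableEq ι] in
/-- The lower-left block is the transpose of the upper-right one. [folklore] -/
private theorem submatrix_swap_eq_transpose'' (p : ι → Prop) {Q : Matrix ι ι ℝ}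
    (hQ : Q.IsHermitian) :
    Q.submatrix (Subtype.val : {i // ¬ p i} → ι) (Subtype.val : {i // p i} → ι)
      = (Q.submatrix (Subtype.val : {i // p i} → ι) (Subtype.val : {i // ¬ p i} → ι))ᵀ := by
  ext b a
  simp [entry_symm'' hQ (a : ι) (b : ι)]

omit [Fintype ι] [DecidableEq ι] in
/-- Off-diagonal blocks of a Z-matrix are `≤ 0`. [folklore] -/
private theorem offBlock_nonpos' (p : ι → Prop) {Q : Matrix ι ι ℝ}
    (hZ : ∀ i j, i ≠ j → Q i j ≤ 0) (a : {i // p i}) (b : {i // ¬ p i}) :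
    Q.submatrix (Subtype.val : {i // p i} → ι) (Subtype.val : {i // ¬ p i} → ι) a b ≤ 0 := by
  have hne : (a : ι) ≠ (b : ι) := fun h => b.2 (h ▸ a.2)
  simpa using hZ _ _ hne

omit [Fintype ι] [DecidableEq ι] in
/-- Principal blocks of a Z-matrix are Z-matrices. [folklore] -/
private theorem block_offDiag_nonpos' (q : ι → Prop) {Q : Matrix ι ι ℝ}
    (hZ : ∀ i j, i ≠ j → Q i j ≤ 0) (b b' : {i // q i}) (h : b ≠ b') :
    Q.submatrix (Subtype.val : {i // q i} → ι) (Subtype.val : {i // q i} → ι) b b' ≤ 0 := by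
  have hne : (b : ι) ≠ (b' : ι) := fun h' => h (Subtype.ext h')
  simpa using hZ _ _ hne

omit [Fintype ι] [DecidableEq ι] in
/-- The interior graph as the graph of the interior block. [folklore] -/
private theorem interiorGraph_adj_iff' (p : ι → Prop) {Q : Matrix ι ι ℝ} {G : SimpleGraph ι}
    (hG : ∀ i j, G.Adj i j ↔ i ≠ j ∧ Q i j ≠ 0) {Gi : SimpleGraph {i // ¬ p i}}
    (hGi : ∀ k l, Gi.Adj k l ↔ G.Adj k l) (k l : {i // ¬ p i}) :
    Gi.Adj k l ↔ k ≠ l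
      ∧ Q.submatrix (Subtype.val : {i // ¬ p i} → ι) (Subtype.val : {i // ¬ p i} → ι) k l ≠ 0 := by
  rw [hGi, hG, Matrix.submatrix_apply]
  exact Iff.and Subtype.coe_ne_coe Iff.rfl

/-- ★★★ **SELF-LOOPS ONLY RAISE THE KRON-REDUCED MATRIX** (Theorem 3.7 3)–4) for the predicate
form of `KronReductionClosure`): `Q` a loopy Laplacian of a connected graph (`Q_ij ≤ 0` off the
diagonal, row sums `≥ 0`), boundary `α = p ≠ ∅`, and `δ ≥ 0` extra self-loops at ANY nodes ⇒ every
entry of the Kron reduction of `Q + diag(δ)` is `≥` the corresponding entry of the Kron reduction of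
`Q`: all mutual couplings `−Q_red[i,j]` weakly decrease, all reduced self-loops weakly increase.
[cite: DorflerBullo2013, §3.2 Theorem 3.7 3)–4) and discussion («decreasing all mutual connections and increasing all self-loops weights») (arXiv:1102.2950 p0014 L67–L95, p0015 L1–L19)] -/
theorem kronReduced_le_kronReduced_add_diagonal (p : ι → Prop) [DecidablePred p] {Q : Matrix ι ι ℝ}
    (hQ : Q.IsHermitian) (hZ : ∀ i j, i ≠ j → Q i j ≤ 0) (hrow : ∀ i, 0 ≤ ∑ j, Q i j)
    {G : SimpleGraph ι} (hG : ∀ i j, G.Adj i j ↔ i ≠ j ∧ Q i j ≠ 0) (hconn : G.Connected)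
    (hα : ∃ i, p i) {δ : ι → ℝ} (hδ : ∀ i, 0 ≤ δ i)
    (a a' : {i // p i}) :
    (Q.submatrix (Subtype.val : {i // p i} → ι) (Subtype.val : {i // p i} → ι)
        - Q.submatrix (Subtype.val : {i // p i} → ι) (Subtype.val : {i // ¬ p i} → ι)
          * (Q.submatrix (Subtype.val : {i // ¬ p i} → ι) (Subtype.val : {i // ¬ p i} → ι))⁻¹
          * Q.submatrix (Subtype.val : {i // ¬ p i} → ι) (Subtype.val : {i // p i} → ι)) a a' ≤ ((Q + Matrix.diagonal δ).submatrix (Subtype.val : {i // p i} → ι) (Subtype.val : {i // p i} → ι)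
        - (Q + Matrix.diagonal δ).submatrix (Subtype.val : {i // p i} → ι) (Subtype.val : {i // ¬ p i} → ι)
          * ((Q + Matrix.diagonal δ).submatrix (Subtype.val : {i // ¬ p i} → ι) (Subtype.val : {i // ¬ p i} → ι))⁻¹
          * (Q + Matrix.diagonal δ).submatrix (Subtype.val : {i // ¬ p i} → ι) (Subtype.val : {i // p i} → ι)) a a' := by
  have hC := interiorBlock_posDef_of_laplacian p hQ hZ hrow hG hconn hα
  obtain ⟨h12, h21⟩ := submatrix_add_diagonal_off p Q δ
  rw [h12, h21, submatrix_add_diagonal_same (fun i => p i) Q δ,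
    submatrix_add_diagonal_same (fun i => ¬ p i) Q δ, submatrix_swap_eq_transpose'' p hQ]
  exact schur_le_schur_add_diagonal _ hC (block_offDiag_nonpos' _ hZ) (offBlock_nonpos' p hZ)
    (fun a => hδ a) (fun b => hδ b) a a'

/-- ★★ **… hence the reduced self-loops (row sums) weakly increase as well.**
[cite: DorflerBullo2013, §3.2 Theorem 3.7 3) («the reduced self-loops satisfy A_red[i,i] = Δ_i + Σ_j Q_ac[i,j]Δ_{|α|+j}») (arXiv:1102.2950 p0014 L88–L90)] -/
theorem kronReduced_rowsum_le_rowsum_add_diagonal (p : ι → Prop) [DecidablePred p] {Q : Matrix ι ι ℝ}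
    (hQ : Q.IsHermitian) (hZ : ∀ i j, i ≠ j → Q i j ≤ 0) (hrow : ∀ i, 0 ≤ ∑ j, Q i j)
    {G : SimpleGraph ι} (hG : ∀ i j, G.Adj i j ↔ i ≠ j ∧ Q i j ≠ 0) (hconn : G.Connected)
    (hα : ∃ i, p i) {δ : ι → ℝ} (hδ : ∀ i, 0 ≤ δ i)
    (a : {i // p i}) :
    ∑ a', (Q.submatrix (Subtype.val : {i // p i} → ι) (Subtype.val : {i // p i} → ι)
        - Q.submatrix (Subtype.val : {i // p i} → ι) (Subtype.val : {i // ¬ p i} → ι)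
          * (Q.submatrix (Subtype.val : {i // ¬ p i} → ι) (Subtype.val : {i // ¬ p i} → ι))⁻¹
          * Q.submatrix (Subtype.val : {i // ¬ p i} → ι) (Subtype.val : {i // p i} → ι)) a a' ≤ ∑ a', ((Q + Matrix.diagonal δ).submatrix (Subtype.val : {i // p i} → ι) (Subtype.val : {i // p i} → ι)
        - (Q + Matrix.diagonal δ).submatrix (Subtype.val : {i // p i} → ι) (Subtype.val : {i // ¬ p i} → ι)
          * ((Q + Matrix.diagonal δ).submatrix (Subtype.val : {i // ¬ p i} → ι) (Subtype.val : {i // ¬ p i} → ι))⁻¹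
          * (Q + Matrix.diagonal δ).submatrix (Subtype.val : {i // ¬ p i} → ι) (Subtype.val : {i // p i} → ι)) a a' :=
  Finset.sum_le_sum fun a' _ => kronReduced_le_kronReduced_add_diagonal p hQ hZ hrow hG hconn hα hδ a a'

/-- ★★★ **THEOREM 3.7 4) (strict): one interior self-loop stiffens the whole reduced network.** If
the interior graph is connected, every boundary node has an interior neighbour, and `δ > 0` at SOME
interior node, then EVERY entry of the Kron reduction strictly increases: all mutual couplings
strictly decrease, all reduced self-loops strictly increase («a single positive self-loop in the
interior network will affect the entire reduced network by decreasing all mutual connections and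
increasing all self-loops weights»).
[cite: DorflerBullo2013, §3.2 Theorem 3.7 4) with proof and the discussion after Theorem 3.7 (arXiv:1102.2950 p0014 L91–L95, p0015 L10–L19, p0016 L1–L3)] -/
theorem kronReduced_lt_kronReduced_add_diagonal (p : ι → Prop) [DecidablePred p] {Q : Matrix ι ι ℝ}
    (hQ : Q.IsHermitian) (hZ : ∀ i j, i ≠ j → Q i j ≤ 0) (hrow : ∀ i, 0 ≤ ∑ j, Q i j)
    {G : SimpleGraph ι} (hG : ∀ i j, G.Adj i j ↔ i ≠ j ∧ Q i j ≠ 0) (hconn : G.Connected)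
    (hα : ∃ i, p i) {Gi : SimpleGraph {i // ¬ p i}}
    (hGi : ∀ k l, Gi.Adj k l ↔ G.Adj k l) (hGic : Gi.Connected)
    (hatt : ∀ a : {i // p i}, ∃ l : {i // ¬ p i}, Q a l ≠ 0)
    {δ : ι → ℝ} (hδ : ∀ i, 0 ≤ δ i) (hpos : ∃ l : {i // ¬ p i}, 0 < δ l) (a a' : {i // p i}) :
    (Q.submatrix (Subtype.val : {i // p i} → ι) (Subtype.val : {i // p i} → ι)
        - Q.submatrix (Subtype.val : {i // p i} → ι) (Subtype.val : {i // ¬ p i} → ι)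
          * (Q.submatrix (Subtype.val : {i // ¬ p i} → ι) (Subtype.val : {i // ¬ p i} → ι))⁻¹
          * Q.submatrix (Subtype.val : {i // ¬ p i} → ι) (Subtype.val : {i // p i} → ι)) a a' < ((Q + Matrix.diagonal δ).submatrix (Subtype.val : {i // p i} → ι) (Subtype.val : {i // p i} → ι)
        - (Q + Matrix.diagonal δ).submatrix (Subtype.val : {i // p i} → ι) (Subtype.val : {i // ¬ p i} → ι)
          * ((Q + Matrix.diagonal δ).submatrix (Subtype.val : {i // ¬ p i} → ι) (Subtype.val : {i // ¬ p i} → ι))⁻¹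
          * (Q + Matrix.diagonal δ).submatrix (Subtype.val : {i // ¬ p i} → ι) (Subtype.val : {i // p i} → ι)) a a' := by
  have hC := interiorBlock_posDef_of_laplacian p hQ hZ hrow hG hconn hα
  obtain ⟨h12, h21⟩ := submatrix_add_diagonal_off p Q δ
  rw [h12, h21, submatrix_add_diagonal_same (fun i => p i) Q δ,
    submatrix_add_diagonal_same (fun i => ¬ p i) Q δ, submatrix_swap_eq_transpose'' p hQ,
    schur_add_diagonal_eq _ _ hC _ (fun b => hδ b), Matrix.add_apply, Matrix.add_apply]
  have h1 : 0 ≤ Matrix.diagonal (fun a : {i // p i} => δ a) a a' := by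
    by_cases h : a = a'
    · subst h; rw [Matrix.diagonal_apply_eq]; exact hδ a
    · rw [Matrix.diagonal_apply_ne _ h]
  obtain ⟨l₀, hl₀⟩ := hpos
  have h2 := selfLoopTerm_apply_pos hC (block_offDiag_nonpos' _ hZ) (offBlock_nonpos' p hZ)
    (fun b => hδ b) (interiorGraph_adj_iff' p hG hGi) hGic
    (fun a => by obtain ⟨l, hl⟩ := hatt a; exact ⟨l, by simpa using hl⟩) ⟨l₀, hl₀⟩ a a'
  linarith

end Predicate

end KronReduction

/-! ### §3. THE MODEL: loads weaken the network-reduced couplings of a lossless grid -/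

namespace ClassicalModel

open KronReduction

variable {ι : Type*} [Fintype ι] [DecidableEq ι]

/-- ★★★ **LOADS WEAKEN THE COUPLINGS OF THE NETWORK-REDUCED MODEL.**  `B` = the susceptance loopy
Laplacian `−Im(Q)` of a connected LOSSLESS network (inductive lines, shunt admittances of
non-positive imaginary part), generators = boundary, `|V_i| > 0`; `δ ≥ 0` = additional inductive
shunt admittances (constant-admittance LOADS, reactors) at any nodes.  Then EVERY
network-reduced coupling weakly decreases, `|V_i||V_j|(−B̃_red[i,j]) ≤ |V_i||V_j|(−B_red[i,j])`
(«Physical intuition also suggests that loads in an electrical circuit weaken the influence of nodes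
on another … a single positive self-loop in the interior network will affect the entire reduced
network by decreasing all mutual connections»).  CERTIFIED: kernel inequality about the algebraic
reduction; MODELLED: lossless, constant-admittance loads, classical machines.
[cite: DorflerBullo2013, §3.2 Theorem 3.7 3)–4) with the discussion after it and before Theorem 3.5 («loads in an electrical circuit weaken the influence of nodes on another») (arXiv:1102.2950 p0013 L37–L41, p0014 L67–L95, p0015 L10–L19); §2.6 (`P_ij = |V_i||V_j| Im(Q_red[i,j])`) (p0010 L17)] -/
theorem kronCoupling_le_of_shunt_le (p : ι → Prop) [DecidablePred p] {B : Matrix ι ι ℝ}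
    (hB : B.IsHermitian) (hZ : ∀ i j, i ≠ j → B i j ≤ 0) (hrow : ∀ i, 0 ≤ ∑ j, B i j)
    {G : SimpleGraph ι} (hG : ∀ i j, G.Adj i j ↔ i ≠ j ∧ B i j ≠ 0) (hconn : G.Connected)
    (hα : ∃ i, p i) (V : ι → ℝ) (hV : ∀ i, 0 < V i) {δ : ι → ℝ}
    (hδ : ∀ i, 0 ≤ δ i) (a a' : {i // p i}) :
    V a * V a' * -(((B + Matrix.diagonal δ).submatrix (Subtype.val : {i // p i} → ι) (Subtype.val : {i // p i} → ι)
        - (B + Matrix.diagonal δ).submatrix (Subtype.val : {i // p i} → ι) (Subtype.val : {i // ¬ p i} → ι)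
          * ((B + Matrix.diagonal δ).submatrix (Subtype.val : {i // ¬ p i} → ι) (Subtype.val : {i // ¬ p i} → ι))⁻¹
          * (B + Matrix.diagonal δ).submatrix (Subtype.val : {i // ¬ p i} → ι) (Subtype.val : {i // p i} → ι)) a a') ≤ V a * V a' * -((B.submatrix (Subtype.val : {i // p i} → ι) (Subtype.val : {i // p i} → ι)
        - B.submatrix (Subtype.val : {i // p i} → ι) (Subtype.val : {i // ¬ p i} → ι)
          * (B.submatrix (Subtype.val : {i // ¬ p i} → ι) (Subtype.val : {i // ¬ p i} → ι))⁻¹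
          * B.submatrix (Subtype.val : {i // ¬ p i} → ι) (Subtype.val : {i // p i} → ι)) a a') := by
  have hVV : 0 ≤ V a * V a' := (mul_pos (hV a) (hV a')).le
  have hle := kronReduced_le_kronReduced_add_diagonal p hB hZ hrow hG hconn hα hδ a a'
  exact mul_le_mul_of_nonneg_left (neg_le_neg hle) hVV

/-- ★★★ **ONE LOADED BUS STRICTLY WEAKENS EVERY COUPLING** (Theorem 3.7 4) read on the power
network): if the bus network is connected, every generator is attached to a bus, and at least one
BUS carries a load (`δ > 0` there), then every network-reduced coupling strictly decreases.
[cite: DorflerBullo2013, §3.2 Theorem 3.7 4) and discussion (arXiv:1102.2950 p0014 L91–L95, p0015 L10–L19); §2.6 (p0010 L17)] -/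
theorem kronCoupling_lt_of_bus_load (p : ι → Prop) [DecidablePred p] {B : Matrix ι ι ℝ}
    (hB : B.IsHermitian) (hZ : ∀ i j, i ≠ j → B i j ≤ 0) (hrow : ∀ i, 0 ≤ ∑ j, B i j)
    {G : SimpleGraph ι} (hG : ∀ i j, G.Adj i j ↔ i ≠ j ∧ B i j ≠ 0) (hconn : G.Connected)
    (hα : ∃ i, p i) (V : ι → ℝ) (hV : ∀ i, 0 < V i)
    {Gi : SimpleGraph {i // ¬ p i}} (hGi : ∀ k l, Gi.Adj k l ↔ G.Adj k l) (hGic : Gi.Connected)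
    (hatt : ∀ a : {i // p i}, ∃ l : {i // ¬ p i}, B a l ≠ 0)
    {δ : ι → ℝ} (hδ : ∀ i, 0 ≤ δ i) (hload : ∃ l : {i // ¬ p i}, 0 < δ l) (a a' : {i // p i}) :
    V a * V a' * -(((B + Matrix.diagonal δ).submatrix (Subtype.val : {i // p i} → ι) (Subtype.val : {i // p i} → ι)
        - (B + Matrix.diagonal δ).submatrix (Subtype.val : {i // p i} → ι) (Subtype.val : {i // ¬ p i} → ι)
          * ((B + Matrix.diagonal δ).submatrix (Subtype.val : {i // ¬ p i} → ι) (Subtype.val : {i // ¬ p i} → ι))⁻¹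
          * (B + Matrix.diagonal δ).submatrix (Subtype.val : {i // ¬ p i} → ι) (Subtype.val : {i // p i} → ι)) a a') < V a * V a' * -((B.submatrix (Subtype.val : {i // p i} → ι) (Subtype.val : {i // p i} → ι)
        - B.submatrix (Subtype.val : {i // p i} → ι) (Subtype.val : {i // ¬ p i} → ι)
          * (B.submatrix (Subtype.val : {i // ¬ p i} → ι) (Subtype.val : {i // ¬ p i} → ι))⁻¹
          * B.submatrix (Subtype.val : {i // ¬ p i} → ι) (Subtype.val : {i // p i} → ι)) a a') := by
  have hVV : 0 < V a * V a' := mul_pos (hV a) (hV a')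
  have hlt := kronReduced_lt_kronReduced_add_diagonal p hB hZ hrow hG hconn hα hGi hGic hatt hδ
    hload a a'
  exact mul_lt_mul_of_pos_left (neg_lt_neg hlt) hVV

/-- ★★ **… AND LOADS RAISE THE REDUCED SHUNTS**: the reduced shunt (row sum of `B_red`) at every
generator weakly increases when loads are added anywhere.
[cite: DorflerBullo2013, §3.2 Theorem 3.7 3) («the reduced self-loops satisfy A_red[i,i] = Δ_i + Σ_j Q_ac[i,j]Δ_j»; «increasing all self-loops weights») (arXiv:1102.2950 p0014 L88–L90, p0015 L17–L19)] -/
theorem kronShunt_le_of_shunt_le (p : ι → Prop) [DecidablePred p] {B : Matrix ι ι ℝ}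
    (hB : B.IsHermitian) (hZ : ∀ i j, i ≠ j → B i j ≤ 0) (hrow : ∀ i, 0 ≤ ∑ j, B i j)
    {G : SimpleGraph ι} (hG : ∀ i j, G.Adj i j ↔ i ≠ j ∧ B i j ≠ 0) (hconn : G.Connected)
    (hα : ∃ i, p i) {δ : ι → ℝ} (hδ : ∀ i, 0 ≤ δ i) (a : {i // p i}) :
    ∑ a', (B.submatrix (Subtype.val : {i // p i} → ι) (Subtype.val : {i // p i} → ι)
        - B.submatrix (Subtype.val : {i // p i} → ι) (Subtype.val : {i // ¬ p i} → ι)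
          * (B.submatrix (Subtype.val : {i // ¬ p i} → ι) (Subtype.val : {i // ¬ p i} → ι))⁻¹
          * B.submatrix (Subtype.val : {i // ¬ p i} → ι) (Subtype.val : {i // p i} → ι)) a a' ≤ ∑ a', ((B + Matrix.diagonal δ).submatrix (Subtype.val : {i // p i} → ι) (Subtype.val : {i // p i} → ι)
        - (B + Matrix.diagonal δ).submatrix (Subtype.val : {i // p i} → ι) (Subtype.val : {i // ¬ p i} → ι)
          * ((B + Matrix.diagonal δ).submatrix (Subtype.val : {i // ¬ p i} → ι) (Subtype.val : {i // ¬ p i} → ι))⁻¹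
          * (B + Matrix.diagonal δ).submatrix (Subtype.val : {i // ¬ p i} → ι) (Subtype.val : {i // p i} → ι)) a a' :=
  kronReduced_rowsum_le_rowsum_add_diagonal p hB hZ hrow hG hconn hα hδ a

end ClassicalModel

end Literature.MathematicalPhysics.PowerSystems
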